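import Summits.QuantumFields.BalabanUV.T4Continuum.Support.SmallFieldDomainsContour
import Summits.QuantumFields.BalabanUV.T4Continuum.Support.NE3CovariantCalculus

/-!
# T⁴ programme, SUBSTRATE — `Support/SmallFieldDomainsNormsCovariant`: DIFFERENCE AND COVARIANT-DIFFERENCE OPERATORS ON THE
# (3.41) CLASSES `WSupLe` — the `|∇_U A|_{(α)}` classes of [Balaban1985BackgroundPropagators] (3.39) ∕ [Balaban1985Variational] (77),
# typed as a JUNCTION of the substrate's multiscale norm (`Support/SmallFieldDomainsNorms`) with row NE3's covariant difference
# `NE3CovariantCalculus.cD` (imported BY NAME — no new covariant derivative is defined)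

Audit cell `pub-balaban`, SUBSTRATE cell seat p4 (focus «multiscale norms ∕ background-field regularity»; the ON-REQUEST library item
B-REQ-1 of `substrate/p4/LIBRARY-SURVEY-p4.md` §2 B2 = LIBRARY v0.1 §8 W-12), companion of `Support/SmallFieldDomainsNorms`, whose header
says *«the covariant derivatives of (3.39) are NOT typed here (they need a configuration and transporters)»* — this file types them,
re-using the configuration-and-transporter vocabulary that EXISTS in the tree (`Site d → Fin d → (Matrix n n ℂ)ˣ`, `Ad`, `cD`, `gaugeAct`,
`unitaryUnits`; the same V3 objects as `SubstrateVocabularyV3.liftCfg` and row NE7's `TermwiseHolder.HolderReg`).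

WHAT IS PRINTED (documentation of the SHAPES; nothing printed is asserted).  [Balaban1985BackgroundPropagators] T. Bałaban, Commun. Math.
Phys. **99** (1985) 389–434, p. 390 (3.3) (held text `paper:balaban1985-cmp99-background-propagators` p. 2–3): *"Let us recall that
R(U)X = UXU⁻¹. … For a matrix valued function A defined at points of the lattice we put (D^η_{U₀}A)(b) = η⁻¹(R(U₀(b))A(b₊) − A(b₋)), or
(D^η_{U₀,μ}A)(x) = (D^η_{U₀}A)(x, x + ηe_μ), μ = 1, …, d. (3.3)"*; p. 397 (3.39): *"|A| = max_μ sup_x |A_μ(x)|, |∇A| = max_{μ,ν} sup_x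
|(D_μA_ν)(x)|"*, and (3.41) (typed in `SmallFieldDomainsNorms`); p. 396 (3.37), the COMPLEX PERTURBATION CLASS these norms define:
*"U′ = e^{iηA′} … |A′| < α₁(L^jη)^{−1}, |∇^η_U A′| < α₁(L^jη)^{−2} on Ω_j"* (the tree's ABSTRACT field `B9.Backgrounds.Cplx337`; §4 below is its
concrete reading: `WSupLe s Ω 1 A′ α₁ ∧ ∀ μ, WSupLe s Ω 2 (cD U μ A′) α₁` in fine units).  [Balaban1985Variational] Commun. Math. Phys. **102** (1985) 277–309,
p. 292 Proposition 4 ∕ (77): the class *"max{|A′|_{(−1)}, |∇A′|_{(−2)}} ≤ ε₃"* (the tree's ABSTRACT field `B11.LGData.nMax`).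

WHAT THIS FILE PROVIDES (all `[folklore]`; fine-lattice units `η = 1` as in every `SmallFieldDomains*` module — the printed prefactor `η⁻¹`
of (3.3) is carried by the consumer's scale exponent; scales GEOMETRIC `s i = c·L^i`; `Ω₀ = T` is the hypothesis `h0 : Ω 0 = Set.univ` wherever a
lattice neighbour must lie in `Ω₀`, as in `SmallFieldDomainsCover`):
 * §1 GEOMETRY OF NEIGHBOURS: for a big-block domain sequence with `1 ≤ R`, `1 ≤ M₁`, `1 ≤ L`, a sup-neighbour `y` of `x` (`Within 1 x y`,
   e.g. `x ± e_μ`) has point index `ι(y) ≥ ι(x) − 1` (`ptIndex_le_ptIndex_add_one_of_within_one`; by symmetry `|ι(x) − ι(y)| ≤ 1`) — the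
   printed separation (1.4) `dist(Ω_jᶜ, Ω_{j+1}) > RM₁L^j ≥ 1`; hence the scale weights at neighbouring points differ by at most `L^{|γ|}`
   (`zpow_scale_le_of_near`, via `SmallFieldDomainsMetricSchur.div_pow_zpow_le` BY NAME).
 * §2 SHIFTS AND DIFFERENCES ON THE CLASSES (any seminormed group `E`): `|A ∘ τ|_{(α)} ≤ L^{|α|}·|A|_{(α)}` for any map `τ` moving points by
   sup-distance `≤ 1` (`WSupLe.comp_within_one`), whence the forward∕backward DIFFERENCE classes `|A(· ± e_μ) − A|_{(α)} ≤ (L^{|α|} + 1)|A|_{(α)}`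
   (`WSupLe.sub_shift_add_e`, `WSupLe.sub_shift_sub_e`) — the lattice derivative costs NO index (the printed `η⁻¹` aside), only the
   neighbour factor `L^{|α|}`; and the `max_μ`-packaging `wSupLe_pi_iff` (a `Fin d → E`-valued field is in the class iff every component is).
 * §3 THE COVARIANT DIFFERENCE (3.3) = row NE3's `cD U μ A x = Ad_{U(x,μ)} A(x + e_μ) − A(x)` on `M_n(ℂ)`-valued fields at UNITARY transporters:
   the flat reading `cD_one_cfg` (`U ≡ 1`: plain forward difference), GAUGE COVARIANCE `cD_gaugeAct` (`cD (U^u) μ (Ad_u A) = Ad_{u(x)} (cD U μ A)`,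
   the (3.31)-type law) and the gauge INVARIANCE of the class (`WSupLe.cD_gaugeAct_iff`); the pointwise sizes `norm_cD_le`
   (`≤ ‖A(x+e_μ)‖ + ‖A x‖`) and `norm_cD_sub_shift_le` (`‖cD U μ A x − (A(x+e_μ) − A x)‖ ≤ 2‖U(x,μ) − 1‖·‖A(x+e_μ)‖`, by
   `AveragingDeficitNearIdentity.norm_Ad_sub_le` BY NAME).
 * §4 THE CLASSES: **`WSupLe.cD`** `|∇_{U,μ} A|_{(α)} ≤ (L^{|α|} + 1)·|A|_{(α)}` at unitary `U`, its adjoint twin `WSupLe.cDstar` and the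
   divergence `WSupLe.cdiv` (row NE3's `cDstar`, `cdiv` BY NAME; (3.8) ∕ the Landau condition (21)); **`WSupLe.cD_sub_shift`** — EXPONENTS ADD:
   `|U_μ − 1|_{(β)} ≤ C_U` and `|A|_{(α)} ≤ C_A` give `|∇_{U,μ}A − ∇_μ A|_{(β+α)} ≤ 2·C_U·L^{|α|}·C_A` (the shape of [Balaban1985Variational]
   (93)–(96) *"these terms … can be estimated by O(1)|∇A′||A′|"*); the (3.39) `max_{μ,ν}` object **`WSupLe.covGrad`** for 1-forms
   `A : Pt d → Fin d → M_n(ℂ)`; print-signed twins `WSupLePrint.cD`, `WSupLePrint.covGrad`, `WSupLePrint.cD_sub_shift`.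
HONEST FRAMING (T4-DAG p. 1).  Norm BOOKKEEPING on `ℤ^d` — a hypothesis-to-hypothesis calculus on the (3.41) classes; no configuration of
Bałaban's is asserted to lie in any class; NO estimate of any NE row ((77)'s smallness, [B11] Prop. 4 and Thm 1 (9) stay the rows' displayed
inputs); the Hölder norms (3.40) remain untyped here (row NE7's `HolderReg` reads them at `U₀ = 1`).  Spine PROVED 0∕9 unchanged; rung (B)+1,
finite T⁴ — NOT infinite volume, NOT a mass gap, NOT Clay.  HONEST DEPENDENCY: continuum YM on T⁴ ⇐ BetaPertH ∧ nine spine estimates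
(0/9 proved); BetaPertH ⇐ (D1) ∧ (D4) ∧ CAP+tail; G-an2-4 gates asym, D1 and NE2/3/4.  No `sorry`.
-/

noncomputable section

open scoped BigOperators

namespace Summit.QuantumFields.BalabanUV.T4Continuum.SmallFieldDomains

open Literature.MathematicalPhysics.QuantumFieldTheory.Balaban1983to89
open B14DomainGeom
open B7Prop1Explicit (e gaugeAct)

variable {d : ℕ}

/-! ## §1 Neighbours in a big-block domain sequence: the point index moves by at most one -/

section Neighbours
variable {L M₁ R k : ℕ} {Ω : ℕ → Set (Pt d)}

/-- `x + e_μ` is a sup-neighbour of `x`. [folklore] -/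
theorem within_one_add_e (x : Pt d) (μ : Fin d) : Within 1 x (x + e μ) := by
  intro i
  simp only [Pi.add_apply, e, Pi.single_apply]
  split_ifs <;> simp

/-- `x − e_μ` is a sup-neighbour of `x`. [folklore] -/
theorem within_one_sub_e (x : Pt d) (μ : Fin d) : Within 1 x (x - e μ) := by
  intro i
  simp only [Pi.sub_apply, e, Pi.single_apply]
  split_ifs <;> simp

/-- The printed separation (1.4) at radius one: for `1 ≤ R`, `1 ≤ M₁`, `1 ≤ L`, a sup-neighbour of a point of `Ω_{j+1}` lies in `Ω_j`.
[folklore] -/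
theorem BigDomainSeq.mem_of_mem_succ_of_within_one (hΩ : BigDomainSeq L M₁ R k Ω) (hR : 1 ≤ R) (hM : 1 ≤ M₁) (hL : 1 ≤ L)
    {j : ℕ} {x y : Pt d} (hx : x ∈ Ω (j + 1)) (hw : Within 1 x y) : y ∈ Ω j := by
  have hR0 : 0 < R := hR
  have hM0 : 0 < M₁ := hM
  have hL0 : 0 < L := hL
  have hrad : (1 : ℤ) ≤ (R : ℤ) * M₁ * L ^ j := by
    have h : 0 < R * M₁ * L ^ j := by positivity
    exact_mod_cast Nat.succ_le_of_lt h
  exact hΩ.sep j x hx y (hw.mono hrad)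

/-- **NEIGHBOURING POINTS HAVE NEIGHBOURING INDICES**: `ι(x) ≤ ι(y) + 1` whenever `y` is a sup-neighbour of `x` (big-block domain sequence,
`1 ≤ R`, `1 ≤ M₁`, `1 ≤ L`). [folklore] -/
theorem ptIndex_le_ptIndex_add_one_of_within_one (hΩ : BigDomainSeq L M₁ R k Ω) (hR : 1 ≤ R) (hM : 1 ≤ M₁) (hL : 1 ≤ L)
    {x y : Pt d} (hw : Within 1 x y) : ptIndex k Ω x ≤ ptIndex k Ω y + 1 := by
  rcases Nat.eq_zero_or_pos (ptIndex k Ω x) with h0 | hpos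
  · omega
  have hi : ptIndex k Ω x - 1 + 1 = ptIndex k Ω x := Nat.sub_add_cancel hpos
  have hxi : x ∈ Ω (ptIndex k Ω x - 1 + 1) := by
    rw [hi]
    exact mem_of_ptIndex_pos hΩ hpos le_rfl
  have hy : y ∈ Ω (ptIndex k Ω x - 1) := hΩ.mem_of_mem_succ_of_within_one hR hM hL hxi hw
  have hle : ptIndex k Ω x - 1 ≤ ptIndex k Ω y :=
    le_ptIndex_of_mem (le_trans (Nat.sub_le _ 1) (ptIndex_le k Ω x)) hy
  omega

/-- Symmetric form: `|ι(x) − ι(y)| ≤ 1` for sup-neighbours. [folklore] -/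
theorem natAbs_ptIndex_sub_le_one_of_within_one (hΩ : BigDomainSeq L M₁ R k Ω) (hR : 1 ≤ R) (hM : 1 ≤ M₁) (hL : 1 ≤ L)
    {x y : Pt d} (hw : Within 1 x y) : ((ptIndex k Ω x : ℤ) - ptIndex k Ω y).natAbs ≤ 1 := by
  have h1 := ptIndex_le_ptIndex_add_one_of_within_one hΩ hR hM hL hw
  have h2 := ptIndex_le_ptIndex_add_one_of_within_one hΩ hR hM hL hw.symm
  omega

/-- **SCALE WEIGHTS AT NEIGHBOURING INDICES**: for geometric scales `s i = c·L^i` (`c > 0`, `1 ≤ L`) and `|j − i| ≤ 1`,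
`(s i)^γ ≤ L^{|γ|}·(s j)^γ` for every integer `γ` (`div_pow_zpow_le` BY NAME). [folklore] -/
theorem zpow_scale_le_of_near {s : ℕ → ℝ} {c : ℝ} (hc : 0 < c) (hL : 1 ≤ L) (hsc : ∀ i, s i = c * (L : ℝ) ^ i) {i j : ℕ}
    (hij : ((j : ℤ) - i).natAbs ≤ 1) (γ : ℤ) : s i ^ γ ≤ (L : ℝ) ^ γ.natAbs * s j ^ γ := by
  have hL' : (1 : ℝ) ≤ L := by exact_mod_cast hL
  have hL0 : (0 : ℝ) < L := lt_of_lt_of_le one_pos hL'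
  have hsj : 0 < s j := by rw [hsc j]; positivity
  have e1 : s i = s j * ((L : ℝ) ^ i / (L : ℝ) ^ j) := by
    rw [hsc i, hsc j, mul_div_assoc', eq_div_iff (pow_ne_zero _ hL0.ne')]
    ring
  have hr : ((L : ℝ) ^ i / (L : ℝ) ^ j) ^ γ ≤ (L : ℝ) ^ γ.natAbs := by
    refine (div_pow_zpow_le hL' γ j i).trans (pow_le_pow_right₀ hL' ?_)
    calc γ.natAbs * ((j : ℤ) - i).natAbs ≤ γ.natAbs * 1 := Nat.mul_le_mul_left _ hij
      _ = γ.natAbs := mul_one _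
  rw [e1, mul_zpow, mul_comm ((L : ℝ) ^ γ.natAbs)]
  exact mul_le_mul_of_nonneg_left hr (zpow_pos hsj γ).le

end Neighbours

/-! ## §2 Shifts and differences on the (3.41) classes -/

section Shift
variable {L M₁ R k : ℕ} {Ω : ℕ → Set (Pt d)} {s : ℕ → ℝ} {E : Type*} [SeminormedAddCommGroup E]

/-- Geometric scales are positive. [folklore] -/
theorem scales_pos_of_geometric {c : ℝ} (hc : 0 < c) (hL : 1 ≤ L) (hsc : ∀ i, s i = c * (L : ℝ) ^ i) (j : ℕ) : 0 < s j := by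
  have hL0 : 0 < L := hL
  rw [hsc j]; positivity

/-- **COMPOSITION WITH A NEAR-IDENTITY MAP**: if `τ` moves every point by sup-distance `≤ 1` (shifts `· ± e_μ`, the identity) and `Ω₀ = T`, then
`|A|_{(α)} ≤ C` gives `|A ∘ τ|_{(α)} ≤ L^{|α|}·C` — the weight at `x` and the weight at `τ x` differ by at most `L^{|α|}` (§1). [folklore] -/
theorem WSupLe.comp_within_one (hΩ : BigDomainSeq L M₁ R k Ω) (h0 : Ω 0 = Set.univ) (hR : 1 ≤ R) (hM : 1 ≤ M₁) (hL : 1 ≤ L)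
    {c : ℝ} (hc : 0 < c) (hsc : ∀ i, s i = c * (L : ℝ) ^ i) {α : ℤ} {A : Pt d → E} {C : ℝ}
    (h : WSupLe s Ω α A C) {τ : Pt d → Pt d} (hτ : ∀ x, Within 1 x (τ x)) :
    WSupLe s Ω α (fun x => A (τ x)) ((L : ℝ) ^ α.natAbs * C) := by
  intro j x hx
  have hx0 : x ∈ Ω 0 := mem_zero_of_mem_layer hΩ hx
  have hy0 : τ x ∈ Ω 0 := by rw [h0]; trivial
  have hjx : ptIndex k Ω x = j := (mem_layer_iff_ptIndex hΩ hx0).mp hx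
  have hy : s (ptIndex k Ω (τ x)) ^ α * ‖A (τ x)‖ ≤ C := h.le (mem_layer_ptIndex hΩ hy0)
  have hnear : ((ptIndex k Ω (τ x) : ℤ) - j).natAbs ≤ 1 := by
    rw [← hjx]
    exact natAbs_ptIndex_sub_le_one_of_within_one hΩ hR hM hL (hτ x).symm
  have hz : s j ^ α ≤ (L : ℝ) ^ α.natAbs * s (ptIndex k Ω (τ x)) ^ α := zpow_scale_le_of_near hc hL hsc hnear α
  have hL0 : (0 : ℝ) ≤ (L : ℝ) ^ α.natAbs := by positivity
  calc s j ^ α * ‖A (τ x)‖ ≤ (L : ℝ) ^ α.natAbs * s (ptIndex k Ω (τ x)) ^ α * ‖A (τ x)‖ :=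
        mul_le_mul_of_nonneg_right hz (norm_nonneg _)
    _ = (L : ℝ) ^ α.natAbs * (s (ptIndex k Ω (τ x)) ^ α * ‖A (τ x)‖) := mul_assoc _ _ _
    _ ≤ (L : ℝ) ^ α.natAbs * C := mul_le_mul_of_nonneg_left hy hL0

/-- The FORWARD SHIFT `A(· + e_μ)`: `|A(· + e_μ)|_{(α)} ≤ L^{|α|}·|A|_{(α)}`. [folklore] -/
theorem WSupLe.shift_add_e (hΩ : BigDomainSeq L M₁ R k Ω) (h0 : Ω 0 = Set.univ) (hR : 1 ≤ R) (hM : 1 ≤ M₁) (hL : 1 ≤ L)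
    {c : ℝ} (hc : 0 < c) (hsc : ∀ i, s i = c * (L : ℝ) ^ i) {α : ℤ} {A : Pt d → E} {C : ℝ}
    (h : WSupLe s Ω α A C) (μ : Fin d) : WSupLe s Ω α (fun x => A (x + e μ)) ((L : ℝ) ^ α.natAbs * C) :=
  h.comp_within_one hΩ h0 hR hM hL hc hsc fun x => within_one_add_e x μ

/-- The BACKWARD SHIFT `A(· − e_μ)`: `|A(· − e_μ)|_{(α)} ≤ L^{|α|}·|A|_{(α)}`. [folklore] -/
theorem WSupLe.shift_sub_e (hΩ : BigDomainSeq L M₁ R k Ω) (h0 : Ω 0 = Set.univ) (hR : 1 ≤ R) (hM : 1 ≤ M₁) (hL : 1 ≤ L)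
    {c : ℝ} (hc : 0 < c) (hsc : ∀ i, s i = c * (L : ℝ) ^ i) {α : ℤ} {A : Pt d → E} {C : ℝ}
    (h : WSupLe s Ω α A C) (μ : Fin d) : WSupLe s Ω α (fun x => A (x - e μ)) ((L : ℝ) ^ α.natAbs * C) :=
  h.comp_within_one hΩ h0 hR hM hL hc hsc fun x => within_one_sub_e x μ

/-- **THE FORWARD DIFFERENCE CLASS**: `|A(· + e_μ) − A|_{(α)} ≤ L^{|α|}·C + C` — in fine-lattice units the lattice derivative `∇^η_μ` (times `η`)
costs no index, only the neighbour factor. [folklore] -/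
theorem WSupLe.sub_shift_add_e (hΩ : BigDomainSeq L M₁ R k Ω) (h0 : Ω 0 = Set.univ) (hR : 1 ≤ R) (hM : 1 ≤ M₁) (hL : 1 ≤ L)
    {c : ℝ} (hc : 0 < c) (hsc : ∀ i, s i = c * (L : ℝ) ^ i) {α : ℤ} {A : Pt d → E} {C : ℝ}
    (h : WSupLe s Ω α A C) (μ : Fin d) : WSupLe s Ω α (fun x => A (x + e μ) - A x) ((L : ℝ) ^ α.natAbs * C + C) :=
  (h.shift_add_e hΩ h0 hR hM hL hc hsc μ).sub (scales_pos_of_geometric hc hL hsc) h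

/-- The BACKWARD DIFFERENCE class: `|A(· − e_μ) − A|_{(α)} ≤ L^{|α|}·C + C`. [folklore] -/
theorem WSupLe.sub_shift_sub_e (hΩ : BigDomainSeq L M₁ R k Ω) (h0 : Ω 0 = Set.univ) (hR : 1 ≤ R) (hM : 1 ≤ M₁) (hL : 1 ≤ L)
    {c : ℝ} (hc : 0 < c) (hsc : ∀ i, s i = c * (L : ℝ) ^ i) {α : ℤ} {A : Pt d → E} {C : ℝ}
    (h : WSupLe s Ω α A C) (μ : Fin d) : WSupLe s Ω α (fun x => A (x - e μ) - A x) ((L : ℝ) ^ α.natAbs * C + C) :=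
  (h.shift_sub_e hΩ h0 hR hM hL hc hsc μ).sub (scales_pos_of_geometric hc hL hsc) h

/-- **THE `max_μ` PACKAGING** of (3.39) (*"|A| = max_μ sup_x |A_μ(x)|"*): a field with values in `ι → E` (sup norm) satisfies `|F|_{(α)} ≤ C`
iff every component does (`0 ≤ C`, positive scales). [folklore] -/
theorem wSupLe_pi_iff {ι : Type*} [Fintype ι] (hs : ∀ j, 0 < s j) {α : ℤ} {F : Pt d → ι → E} {C : ℝ} (hC : 0 ≤ C) :
    WSupLe s Ω α F C ↔ ∀ i, WSupLe s Ω α (fun x => F x i) C := by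
  constructor
  · intro h i j x hx
    exact (mul_le_mul_of_nonneg_left (norm_le_pi_norm (F x) i) (zpow_pos (hs j) α).le).trans (h j x hx)
  · intro h j x hx
    have hsα : 0 < s j ^ α := zpow_pos (hs j) α
    rw [mul_comm, ← le_div_iff₀ hsα]
    refine (pi_norm_le_iff_of_nonneg (div_nonneg hC hsα.le)).mpr fun i => ?_
    rw [le_div_iff₀ hsα, mul_comm]
    exact h i j x hx

end Shift

/-! ## §3 The covariant difference (3.3) = `NE3CovariantCalculus.cD`, at unitary transporters -/

section Covariant
open scoped Matrix.Norms.L2Operator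
open T4AveragingDeficitWall (Ad IsUnitaryCfg)
open B7Prop2Explicit (unitaryUnits)
open T4AveragingDeficitNonAbelian (Ad_mul Ad_sub)
open NE3CovariantCalculus (cD cDstar cdiv)
open AveragingDeficitTransport (norm_Ad_of_unitary)
open AveragingDeficitNearIdentity (norm_Ad_sub_le Ad_one)

variable {n : Type*} [Fintype n] [DecidableEq n]

/-- THE FLAT READING: at `U ≡ 1` the covariant difference is the plain forward difference. [folklore] -/
theorem cD_one_cfg (μ : Fin d) (A : Pt d → Matrix n n ℂ) (x : Pt d) :
    cD (1 : Pt d → Fin d → (Matrix n n ℂ)ˣ) μ A x = A (x + e μ) - A x := by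
  simp only [cD, Pi.one_apply, Ad_one]

/-- **GAUGE COVARIANCE** (the (3.31)-type law for (3.3)): `cD (U^u) μ (Ad_u A) (x) = Ad_{u(x)} (cD U μ A (x))`, where
`U^u(x,μ) = u(x)U(x,μ)u(x+e_μ)⁻¹` (`B7Prop1Explicit.gaugeAct`) and the field transforms in the adjoint way at its base point. [folklore] -/
theorem cD_gaugeAct (u : Pt d → (Matrix n n ℂ)ˣ) (U : Pt d → Fin d → (Matrix n n ℂ)ˣ) (μ : Fin d) (A : Pt d → Matrix n n ℂ)
    (x : Pt d) :
    cD (gaugeAct u U) μ (fun y => Ad (u y) (A y)) x = Ad (u x) (cD U μ A x) := by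
  simp only [cD, gaugeAct]
  rw [← Ad_mul, inv_mul_cancel_right, Ad_mul, Ad_sub]

/-- Pointwise size at a unitary transporter: `‖cD U μ A x‖ ≤ ‖A(x + e_μ)‖ + ‖A x‖` (`‖Ad_U X‖ = ‖X‖`). [folklore] -/
theorem norm_cD_le {U : Pt d → Fin d → (Matrix n n ℂ)ˣ} {x : Pt d} {μ : Fin d} (hU : U x μ ∈ unitaryUnits (Matrix n n ℂ))
    (A : Pt d → Matrix n n ℂ) :
    ‖cD U μ A x‖ ≤ ‖A (x + e μ)‖ + ‖A x‖ := by
  unfold cD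
  exact (norm_sub_le _ _).trans (by rw [norm_Ad_of_unitary hU])

/-- **COVARIANT MINUS FLAT**: `‖cD U μ A x − (A(x+e_μ) − A x)‖ ≤ 2‖U(x,μ) − 1‖·‖A(x+e_μ)‖` at a unitary transporter
(`AveragingDeficitNearIdentity.norm_Ad_sub_le` BY NAME) — the shape behind (93)–(96)'s `O(1)|∇A′||A′|`-type cross terms. [folklore] -/
theorem norm_cD_sub_shift_le [Nonempty n] {U : Pt d → Fin d → (Matrix n n ℂ)ˣ} {x : Pt d} {μ : Fin d}
    (hU : U x μ ∈ unitaryUnits (Matrix n n ℂ)) (A : Pt d → Matrix n n ℂ) :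
    ‖cD U μ A x - (A (x + e μ) - A x)‖ ≤ 2 * ‖(U x μ : Matrix n n ℂ) - 1‖ * ‖A (x + e μ)‖ := by
  have e1 : cD U μ A x - (A (x + e μ) - A x) = Ad (U x μ) (A (x + e μ)) - A (x + e μ) := by
    unfold cD; abel
  rw [e1]
  exact norm_Ad_sub_le hU _

variable {L M₁ R k : ℕ} {Ω : ℕ → Set (Pt d)} {s : ℕ → ℝ}

/-- **GAUGE INVARIANCE OF THE CLASS**: at unitary `u`, `|∇_{U^u,μ}(Ad_u A)|_{(α)} ≤ C ↔ |∇_{U,μ} A|_{(α)} ≤ C`. [folklore] -/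
theorem WSupLe.cD_gaugeAct_iff {u : Pt d → (Matrix n n ℂ)ˣ} (hu : ∀ x, u x ∈ unitaryUnits (Matrix n n ℂ))
    (U : Pt d → Fin d → (Matrix n n ℂ)ˣ) (μ : Fin d) (A : Pt d → Matrix n n ℂ) (α : ℤ) (C : ℝ) :
    WSupLe s Ω α (NE3CovariantCalculus.cD (gaugeAct u U) μ (fun y => Ad (u y) (A y))) C ↔
      WSupLe s Ω α (NE3CovariantCalculus.cD U μ A) C := by
  simp only [WSupLe, cD_gaugeAct, norm_Ad_of_unitary (hu _)]

/-! ## §4 The (3.39) ∕ (77) classes of the covariant difference -/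

/-- **`|∇_{U,μ} A|_{(α)} ≤ L^{|α|}·C + C`** from `|A|_{(α)} ≤ C`, at a configuration `U` unitary in direction `μ` (big-block domain sequence with
`Ω₀ = T`, `1 ≤ R`, `1 ≤ M₁`, `1 ≤ L`, geometric scales). [folklore] -/
theorem WSupLe.cD (hΩ : BigDomainSeq L M₁ R k Ω) (h0 : Ω 0 = Set.univ) (hR : 1 ≤ R) (hM : 1 ≤ M₁) (hL : 1 ≤ L)
    {c : ℝ} (hc : 0 < c) (hsc : ∀ i, s i = c * (L : ℝ) ^ i) {U : Pt d → Fin d → (Matrix n n ℂ)ˣ} {μ : Fin d}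
    (hU : ∀ x, U x μ ∈ unitaryUnits (Matrix n n ℂ)) {α : ℤ} {A : Pt d → Matrix n n ℂ} {C : ℝ} (h : WSupLe s Ω α A C) :
    WSupLe s Ω α (NE3CovariantCalculus.cD U μ A) ((L : ℝ) ^ α.natAbs * C + C) := by
  have hs := scales_pos_of_geometric hc hL hsc
  have hsh := h.shift_add_e hΩ h0 hR hM hL hc hsc μ
  intro j x hx
  have hsα : 0 ≤ s j ^ α := (zpow_pos (hs j) α).le
  calc s j ^ α * ‖NE3CovariantCalculus.cD U μ A x‖ ≤ s j ^ α * (‖A (x + e μ)‖ + ‖A x‖) := mul_le_mul_of_nonneg_left (norm_cD_le (hU x) A) hsα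
    _ = s j ^ α * ‖A (x + e μ)‖ + s j ^ α * ‖A x‖ := mul_add _ _ _
    _ ≤ (L : ℝ) ^ α.natAbs * C + C := add_le_add (hsh j x hx) (h j x hx)

/-- **THE ADJOINT ∕ BACKWARD COVARIANT DIFFERENCE** (row NE3's `cDstar U μ A x = Ad_{U(x−e_μ,μ)}⁻¹ A(x−e_μ) − A(x)`, the (3.8)-type
formal adjoint): `|∇*_{U,μ} A|_{(α)} ≤ L^{|α|}·C + C` from `|A|_{(α)} ≤ C` at transporters unitary in direction `μ`. [folklore] -/
theorem WSupLe.cDstar (hΩ : BigDomainSeq L M₁ R k Ω) (h0 : Ω 0 = Set.univ) (hR : 1 ≤ R) (hM : 1 ≤ M₁) (hL : 1 ≤ L)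
    {c : ℝ} (hc : 0 < c) (hsc : ∀ i, s i = c * (L : ℝ) ^ i) {U : Pt d → Fin d → (Matrix n n ℂ)ˣ} {μ : Fin d}
    (hU : ∀ x, U x μ ∈ unitaryUnits (Matrix n n ℂ)) {α : ℤ} {A : Pt d → Matrix n n ℂ} {C : ℝ} (h : WSupLe s Ω α A C) :
    WSupLe s Ω α (NE3CovariantCalculus.cDstar U μ A) ((L : ℝ) ^ α.natAbs * C + C) := by
  have hs := scales_pos_of_geometric hc hL hsc
  have hsh := h.shift_sub_e hΩ h0 hR hM hL hc hsc μ
  intro j x hx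
  have hsα : 0 ≤ s j ^ α := (zpow_pos (hs j) α).le
  have hpt : ‖NE3CovariantCalculus.cDstar U μ A x‖ ≤ ‖A (x - e μ)‖ + ‖A x‖ := by
    unfold NE3CovariantCalculus.cDstar
    exact (norm_sub_le _ _).trans (by rw [norm_Ad_of_unitary ((unitaryUnits (Matrix n n ℂ)).inv_mem (hU _))])
  calc s j ^ α * ‖NE3CovariantCalculus.cDstar U μ A x‖ ≤ s j ^ α * (‖A (x - e μ)‖ + ‖A x‖) := mul_le_mul_of_nonneg_left hpt hsα
    _ = s j ^ α * ‖A (x - e μ)‖ + s j ^ α * ‖A x‖ := mul_add _ _ _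
    _ ≤ (L : ℝ) ^ α.natAbs * C + C := add_le_add (hsh j x hx) (h j x hx)

/-- **THE COVARIANT DIVERGENCE** (row NE3's `cdiv U A x = Σ_μ (A_μ(x) − Ad_{U(x−e_μ,μ)}⁻¹ A_μ(x−e_μ))`, through which the Landau condition
`R(U)D*A = 0` of [Balaban1985Variational] (21) reads): `|cdiv U A|_{(α)} ≤ d·(C + L^{|α|}·C)` from `|A|_{(α)} ≤ C` for a 1-form
`A : Pt d → Fin d → M_n(ℂ)` (sup norm over the components) at a unitary configuration. [folklore] -/
theorem WSupLe.cdiv (hΩ : BigDomainSeq L M₁ R k Ω) (h0 : Ω 0 = Set.univ) (hR : 1 ≤ R) (hM : 1 ≤ M₁) (hL : 1 ≤ L)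
    {c : ℝ} (hc : 0 < c) (hsc : ∀ i, s i = c * (L : ℝ) ^ i) {U : Pt d → Fin d → (Matrix n n ℂ)ˣ} (hU : IsUnitaryCfg U)
    {α : ℤ} {A : Pt d → Fin d → Matrix n n ℂ} {C : ℝ} (h : WSupLe s Ω α A C) :
    WSupLe s Ω α (NE3CovariantCalculus.cdiv U A) (d * (C + (L : ℝ) ^ α.natAbs * C)) := by
  have hs := scales_pos_of_geometric hc hL hsc
  intro j x hx
  have hsα : 0 ≤ s j ^ α := (zpow_pos (hs j) α).le
  have hterm : ∀ μ : Fin d, s j ^ α * ‖A x μ - Ad (U (x - e μ) μ)⁻¹ (A (x - e μ) μ)‖ ≤ C + (L : ℝ) ^ α.natAbs * C := by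
    intro μ
    have h1 : s j ^ α * ‖A x μ‖ ≤ C := (mul_le_mul_of_nonneg_left (norm_le_pi_norm (A x) μ) hsα).trans (h j x hx)
    have h2 : s j ^ α * ‖A (x - e μ) μ‖ ≤ (L : ℝ) ^ α.natAbs * C :=
      (mul_le_mul_of_nonneg_left (norm_le_pi_norm (A (x - e μ)) μ) hsα).trans ((h.shift_sub_e hΩ h0 hR hM hL hc hsc μ) j x hx)
    have hAd : ‖Ad (U (x - e μ) μ)⁻¹ (A (x - e μ) μ)‖ = ‖A (x - e μ) μ‖ :=
      norm_Ad_of_unitary ((unitaryUnits (Matrix n n ℂ)).inv_mem (hU _ _)) _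
    calc s j ^ α * ‖A x μ - Ad (U (x - e μ) μ)⁻¹ (A (x - e μ) μ)‖ ≤ s j ^ α * (‖A x μ‖ + ‖A (x - e μ) μ‖) :=
          mul_le_mul_of_nonneg_left ((norm_sub_le _ _).trans (by rw [hAd])) hsα
      _ ≤ C + (L : ℝ) ^ α.natAbs * C := by rw [mul_add]; exact add_le_add h1 h2
  calc s j ^ α * ‖NE3CovariantCalculus.cdiv U A x‖
        ≤ s j ^ α * ∑ μ : Fin d, ‖A x μ - Ad (U (x - e μ) μ)⁻¹ (A (x - e μ) μ)‖ :=
          mul_le_mul_of_nonneg_left (norm_sum_le _ _) hsα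
    _ = ∑ μ : Fin d, s j ^ α * ‖A x μ - Ad (U (x - e μ) μ)⁻¹ (A (x - e μ) μ)‖ := Finset.mul_sum _ _ _
    _ ≤ ∑ _μ : Fin d, (C + (L : ℝ) ^ α.natAbs * C) := Finset.sum_le_sum fun μ _ => hterm μ
    _ = d * (C + (L : ℝ) ^ α.natAbs * C) := by rw [Finset.sum_const, Finset.card_univ, Fintype.card_fin, nsmul_eq_mul]

/-- **EXPONENTS ADD FOR THE CROSS TERM**: `|U_μ − 1|_{(β)} ≤ C_U` (transporter smallness in direction `μ`, as a field on points) and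
`|A|_{(α)} ≤ C_A` give `|∇_{U,μ} A − (A(·+e_μ) − A)|_{(β+α)} ≤ 2·C_U·(L^{|α|}·C_A)`. [folklore] -/
theorem WSupLe.cD_sub_shift [Nonempty n] (hΩ : BigDomainSeq L M₁ R k Ω) (h0 : Ω 0 = Set.univ) (hR : 1 ≤ R) (hM : 1 ≤ M₁)
    (hL : 1 ≤ L) {c : ℝ} (hc : 0 < c) (hsc : ∀ i, s i = c * (L : ℝ) ^ i) {U : Pt d → Fin d → (Matrix n n ℂ)ˣ} {μ : Fin d}
    (hU : ∀ x, U x μ ∈ unitaryUnits (Matrix n n ℂ)) {β α : ℤ} {A : Pt d → Matrix n n ℂ} {C_U C_A : ℝ}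
    (hUβ : WSupLe s Ω β (fun x => (U x μ : Matrix n n ℂ) - 1) C_U) (hA : WSupLe s Ω α A C_A) :
    WSupLe s Ω (β + α) (fun x => NE3CovariantCalculus.cD U μ A x - (A (x + e μ) - A x))
      (2 * C_U * ((L : ℝ) ^ α.natAbs * C_A)) := by
  have hs := scales_pos_of_geometric hc hL hsc
  have hsh := hA.shift_add_e hΩ h0 hR hM hL hc hsc μ
  intro j x hx
  have hsβ : 0 ≤ s j ^ β := (zpow_pos (hs j) β).le
  have hsα : 0 ≤ s j ^ α := (zpow_pos (hs j) α).le
  have h1 : s j ^ β * ‖(U x μ : Matrix n n ℂ) - 1‖ ≤ C_U := hUβ j x hx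
  have h2 : s j ^ α * ‖A (x + e μ)‖ ≤ (L : ℝ) ^ α.natAbs * C_A := hsh j x hx
  have hCU : 0 ≤ C_U := le_trans (mul_nonneg hsβ (norm_nonneg _)) h1
  calc s j ^ (β + α) * ‖NE3CovariantCalculus.cD U μ A x - (A (x + e μ) - A x)‖
        ≤ s j ^ (β + α) * (2 * ‖(U x μ : Matrix n n ℂ) - 1‖ * ‖A (x + e μ)‖) :=
          mul_le_mul_of_nonneg_left (norm_cD_sub_shift_le (hU x) A) (zpow_pos (hs j) _).le
    _ = 2 * (s j ^ β * ‖(U x μ : Matrix n n ℂ) - 1‖) * (s j ^ α * ‖A (x + e μ)‖) := by rw [zpow_add₀ (hs j).ne']; ring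
    _ ≤ 2 * C_U * ((L : ℝ) ^ α.natAbs * C_A) :=
          mul_le_mul (mul_le_mul_of_nonneg_left h1 zero_le_two) h2 (mul_nonneg hsα (norm_nonneg _))
            (mul_nonneg zero_le_two hCU)

/-- **THE (3.39) OBJECT `∇_U A` OF A 1-FORM** `A : Pt d → Fin d → M_n(ℂ)` (components `A_ν`, sup norm over `ν` = print's `max_ν`): the field
`x ↦ ((μ,ν) ↦ (∇_{U,μ}A_ν)(x))` with the sup norm over `(μ,ν)` = print's `max_{μ,ν}`; at a unitary configuration `|∇_U A|_{(α)} ≤ L^{|α|}·C + C`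
from `|A|_{(α)} ≤ C`. [folklore] -/
theorem WSupLe.covGrad (hΩ : BigDomainSeq L M₁ R k Ω) (h0 : Ω 0 = Set.univ) (hR : 1 ≤ R) (hM : 1 ≤ M₁) (hL : 1 ≤ L)
    {c : ℝ} (hc : 0 < c) (hsc : ∀ i, s i = c * (L : ℝ) ^ i) {U : Pt d → Fin d → (Matrix n n ℂ)ˣ} (hU : IsUnitaryCfg U)
    {α : ℤ} {A : Pt d → Fin d → Matrix n n ℂ} {C : ℝ} (hC : 0 ≤ C) (h : WSupLe s Ω α A C) :
    WSupLe s Ω α (fun x => fun p : Fin d × Fin d => NE3CovariantCalculus.cD U p.1 (fun y => A y p.2) x)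
      ((L : ℝ) ^ α.natAbs * C + C) := by
  have hs := scales_pos_of_geometric hc hL hsc
  have hC' : 0 ≤ (L : ℝ) ^ α.natAbs * C + C := by positivity
  rw [wSupLe_pi_iff hs hC']
  rintro ⟨μ, ν⟩
  exact ((wSupLe_pi_iff hs hC).mp h ν).cD hΩ h0 hR hM hL hc hsc (fun x => hU x μ)

/-- Print-signed twin of `WSupLe.cD`: `WSupLePrint s Ω a A C → WSupLePrint s Ω a (∇_{U,μ}A) (L^{|a|}·C + C)`. [folklore] -/
theorem WSupLePrint.cD (hΩ : BigDomainSeq L M₁ R k Ω) (h0 : Ω 0 = Set.univ) (hR : 1 ≤ R) (hM : 1 ≤ M₁) (hL : 1 ≤ L)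
    {c : ℝ} (hc : 0 < c) (hsc : ∀ i, s i = c * (L : ℝ) ^ i) {U : Pt d → Fin d → (Matrix n n ℂ)ˣ} {μ : Fin d}
    (hU : ∀ x, U x μ ∈ unitaryUnits (Matrix n n ℂ)) {a : ℤ} {A : Pt d → Matrix n n ℂ} {C : ℝ} (h : WSupLePrint s Ω a A C) :
    WSupLePrint s Ω a (NE3CovariantCalculus.cD U μ A) ((L : ℝ) ^ a.natAbs * C + C) := by
  have h' := WSupLe.cD hΩ h0 hR hM hL hc hsc hU h
  rwa [Int.natAbs_neg] at h'

/-- Print-signed twin of `WSupLe.covGrad` (the (3.39) object `∇_U A` of a 1-form in print's index). [folklore] -/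
theorem WSupLePrint.covGrad (hΩ : BigDomainSeq L M₁ R k Ω) (h0 : Ω 0 = Set.univ) (hR : 1 ≤ R) (hM : 1 ≤ M₁) (hL : 1 ≤ L)
    {c : ℝ} (hc : 0 < c) (hsc : ∀ i, s i = c * (L : ℝ) ^ i) {U : Pt d → Fin d → (Matrix n n ℂ)ˣ} (hU : IsUnitaryCfg U)
    {a : ℤ} {A : Pt d → Fin d → Matrix n n ℂ} {C : ℝ} (hC : 0 ≤ C) (h : WSupLePrint s Ω a A C) :
    WSupLePrint s Ω a (fun x => fun p : Fin d × Fin d => NE3CovariantCalculus.cD U p.1 (fun y => A y p.2) x)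
      ((L : ℝ) ^ a.natAbs * C + C) := by
  have h' := WSupLe.covGrad hΩ h0 hR hM hL hc hsc hU hC h
  rwa [Int.natAbs_neg] at h'

/-- Print-signed twin of `WSupLe.cD_sub_shift` (print indices `b`, `a`, conclusion at `b + a`; e.g. `b = a = −1` in (77)'s letters
gives the `(−2)`-class of the cross term). [folklore] -/
theorem WSupLePrint.cD_sub_shift [Nonempty n] (hΩ : BigDomainSeq L M₁ R k Ω) (h0 : Ω 0 = Set.univ) (hR : 1 ≤ R) (hM : 1 ≤ M₁)
    (hL : 1 ≤ L) {c : ℝ} (hc : 0 < c) (hsc : ∀ i, s i = c * (L : ℝ) ^ i) {U : Pt d → Fin d → (Matrix n n ℂ)ˣ} {μ : Fin d}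
    (hU : ∀ x, U x μ ∈ unitaryUnits (Matrix n n ℂ)) {b a : ℤ} {A : Pt d → Matrix n n ℂ} {C_U C_A : ℝ}
    (hUβ : WSupLePrint s Ω b (fun x => (U x μ : Matrix n n ℂ) - 1) C_U) (hA : WSupLePrint s Ω a A C_A) :
    WSupLePrint s Ω (b + a) (fun x => NE3CovariantCalculus.cD U μ A x - (A (x + e μ) - A x))
      (2 * C_U * ((L : ℝ) ^ a.natAbs * C_A)) := by
  have h' := WSupLe.cD_sub_shift hΩ h0 hR hM hL hc hsc hU hUβ hA
  rw [Int.natAbs_neg] at h'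
  rw [wSupLePrint_iff, neg_add]
  exact h'

end Covariant

end Summit.QuantumFields.BalabanUV.T4Continuum.SmallFieldDomains

end
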